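import Summits.ValiantsHypothesis.ValiantsHypothesis.Theorems.KPlusLogSqLawStaticTridiagonalChain

/-!
# Route «KPlusLogSqLaw» — scaling and perturbing a static tridiagonal design (toward the unconditional `O(m log m)` chain law)

HONEST FRAMING.  Helper toward the crux `WeakLifting` (item `stmt-ValiantsHypothesis-19561`, route `KPlusLogSqLaw`, cell `pub-symmetroid`,
seat val-sym-lift-p3 g6, 2026-08-27) on the line of its witness-plan stub `stub_tridiagonalSectorB`: step (T5) of
HOME/val-sym-lift-p3/g6/FOLD-LEMMA-AND-WIDTH2-TRELLIS-liftp3g6.md §A2, first half.  The conditional law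
`StaticTridiagonal.chain_le_of_static_tridiagonal` needs the item lines of the design to have no identically vanishing alternating interval sum;
this file provides the two DOMINANCE-PRESERVING operations used to reach that situation: SCALING all valuations and slopes by `N ≥ 1`
(`tropWeight_scale`, `isDominant_scale`) and PERTURBING the valuations by a class-independent table `δ ≥ 0` with `m · max δ < N` after scaling
by `N` (`tropWeight_perturb`, `isDominant_scale_perturb`: a dominance gap `≥ 1` becomes `≥ N`, which absorbs the perturbation).  The choice of
`δ` (distinct powers of two off the diagonal) and the resulting non-vanishing of the alternating sums are left to the next file.  Nothing here
asserts anything about `WeakLifting`, `TropicalB`, `KPlusLogSqLaw`, the stub in its window, `MatrixDescartes` (stmt-ValiantsHypothesis-18050) or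
`VP ≠ VNP`.
-/

set_option linter.dupNamespace false
set_option autoImplicit false

namespace Summit.ValiantsHypothesis.ValiantsHypothesis.Theorems.KPlusLogSqLaw

open Finset Classical
open Summit.ValiantsHypothesis.ValiantsHypothesis.Theorems.MatrixDescartes.Negative

namespace StaticTridiagonal

variable {m K : ℕ}

/-- the perturbation mass of a term: `Σ_c δ (σ c) c`. [folklore] -/
theorem tropWeight_perturb (d : Fin K → ℕ) (v : Fin m → Fin m → Fin K → ℤ) (δ : Fin m → Fin m → ℤ) (N θ : ℤ)
    (p : Equiv.Perm (Fin m) × (Fin m → Fin K)) :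
    tropWeight d (fun i j l => N * v i j l + δ i j) (N * θ) p = N * tropWeight d v θ p - ∑ c, δ (p.1 c) c := by
  unfold tropWeight
  rw [Finset.sum_add_distrib]
  have h1 : ∑ c, N * v (p.1 c) c (p.2 c) = N * ∑ c, v (p.1 c) c (p.2 c) := by rw [Finset.mul_sum]
  rw [h1]; ring

/-- **scaling and perturbing preserve dominance**: if `p` is dominant at `θ` for `(d, v, ε)`, `0 ≤ δ ≤ D` entrywise and `m · D < N`, then `p`
is dominant at `N θ` for `(d, N v + δ, ε)`. [folklore] -/
theorem isDominant_scale_perturb (d : Fin K → ℕ) (v ε : Fin m → Fin m → Fin K → ℤ) (δ : Fin m → Fin m → ℤ) (N D θ : ℤ)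
    (hδ0 : ∀ i j, 0 ≤ δ i j) (hδD : ∀ i j, δ i j ≤ D) (hN : (m : ℤ) * D < N)
    {p : Equiv.Perm (Fin m) × (Fin m → Fin K)} (hp : IsDominant d v ε θ p) :
    IsDominant d (fun i j l => N * v i j l + δ i j) ε (N * θ) p := by
  refine ⟨hp.1, fun p' hne hpres => ?_⟩
  have hlt := hp.2 p' hne hpres
  rw [tropWeight_perturb, tropWeight_perturb]
  have h1 : tropWeight d v θ p' + 1 ≤ tropWeight d v θ p := hlt
  have h2 : 0 ≤ ∑ c, δ (p'.1 c) c := Finset.sum_nonneg fun c _ => hδ0 _ _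
  have h3 : ∑ c, δ (p.1 c) c ≤ (m : ℤ) * D := by
    calc ∑ c, δ (p.1 c) c ≤ ∑ _c : Fin m, D := Finset.sum_le_sum fun c _ => hδD _ _
      _ = (m : ℤ) * D := by rw [Finset.sum_const, Finset.card_univ, Fintype.card_fin]; ring
  have hN0 : 0 ≤ N := by
    have : (0 : ℤ) ≤ (m : ℤ) * D := by
      rcases Nat.eq_zero_or_pos m with h0 | h0
      · subst h0; simp
      · have hD : 0 ≤ D := (hδ0 ⟨0, h0⟩ ⟨0, h0⟩).trans (hδD _ _)
        positivity
    linarith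
  nlinarith

/-- scaling the slopes keeps them strictly increasing. [folklore] -/
theorem strictMono_mul {n : ℕ} {θ : Fin (n + 1) → ℤ} (hθ : StrictMono θ) {N : ℤ} (hN : 0 < N) :
    StrictMono fun k => N * θ k := fun a b hab => by
  have := hθ hab
  nlinarith

/-- the perturbed valuation table read off the class table: `vN cls (N v + δ) r c = N · vN cls v r c + δN r c` where `δN` extends `δ` by `0`. [folklore] -/
theorem vN_perturb (cls : Fin m → Fin m → Fin K) (v : Fin m → Fin m → Fin K → ℤ) (δ : Fin m → Fin m → ℤ) (N : ℤ) (r c : ℕ) :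
    vN cls (fun i j l => N * v i j l + δ i j) r c =
      (N : ℝ) * vN cls v r c + (if h : r < m ∧ c < m then (δ ⟨r, h.1⟩ ⟨c, h.2⟩ : ℝ) else 0) := by
  unfold vN
  split_ifs with h
  · push_cast; ring
  · simp

/-- the perturbed item intercepts: `itemIcpt cls (N v + δ) t = N · itemIcpt cls v t − (alternating-free combination of δ)`. [folklore] -/
theorem itemIcpt_perturb (cls : Fin m → Fin m → Fin K) (v : Fin m → Fin m → Fin K → ℤ) (δ : Fin m → Fin m → ℤ) (N : ℤ) (t : ℕ) :
    itemIcpt cls (fun i j l => N * v i j l + δ i j) t =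
      (N : ℝ) * itemIcpt cls v t -
        ((if h : t < m ∧ t - 1 < m then (δ ⟨t, h.1⟩ ⟨t - 1, h.2⟩ : ℝ) else 0) +
          (if h : t - 1 < m ∧ t < m then (δ ⟨t - 1, h.1⟩ ⟨t, h.2⟩ : ℝ) else 0) -
          (if h : t - 1 < m ∧ t - 1 < m then (δ ⟨t - 1, h.1⟩ ⟨t - 1, h.2⟩ : ℝ) else 0) -
          (if h : t < m ∧ t < m then (δ ⟨t, h.1⟩ ⟨t, h.2⟩ : ℝ) else 0)) := by
  unfold itemIcpt
  rw [vN_perturb, vN_perturb, vN_perturb, vN_perturb]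
  ring

end StaticTridiagonal

end Summit.ValiantsHypothesis.ValiantsHypothesis.Theorems.KPlusLogSqLaw
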